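import Summits.BirchSwinnertonDyer.BirchSwinnertonDyer.Theorems.KolyvaginDepthDoorDepthTableRowsExactReadingZhang3
import Summits.BirchSwinnertonDyer.BirchSwinnertonDyer.Theorems.KolyvaginDepthDoorDepthTableRowsTwoSha1
import Summits.BirchSwinnertonDyer.BirchSwinnertonDyer.Theorems.KolyvaginDepthDoorDepthTableRowKitSecondSign
import Summits.BirchSwinnertonDyer.BirchSwinnertonDyer.Theorems.Rank2ObservatoryKernelAnnihilator
import Literature.NumberTheory.EllipticCurves.IrreducibleModPQuadraticTwistProofs
import Literature.NumberTheory.EllipticCurves.NonEisensteinPrimeOfSurjective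
import Literature.NumberTheory.EllipticCurves.LeadingTermProofs
import HarnessLib

/-!
# Route `KolyvaginDepthDoor`, crux `KolyvaginDepthSupplyKN` (stmt-BirchSwinnertonDyer-22820) —
# DEPTH TABLE v12 for the uncertified rows `997b1`, `997c1` at the Heegner field `d_K = −23` (`5` inert):
# «ONE BIT ⟺ `rank E = 2` ∧ TWO `Ш`'s», twist points SUPPLIED IN THE KERNEL

Helper file of the lead prover of line `levelone` (kdd-p1 g16; `--supports stmt-BirchSwinnertonDyer-22820
--as helper`); it closes nothing and BSD is not proved by it.

`997b1 = [0, -1, 1, -5, -3]` and `997c1 = [0, -1, 1, -24, 54]` (`N = Δ = 997` prime, ♠ cell) are, with `794a1`, the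
depth-table curves WITHOUT a kernel 2-descent certificate (totally real cubic `2`-division fields; observatory
residual class), so their rows keep `rank E(ℚ) = 2` in the answer. Their rows of record are `(5, −52, 199)` and
`(5, −67, 229)`; sieved searches to `|u| ≤ 10⁸` found NO rational point on `E^{(−52)}` resp. `E^{(−67)}`. The exact
reading holds for ANY Heegner field with `5 ∤ d_K`; the least Heegner discriminant of `997` with `5` inert is
`d_K = −23` (`h_K = 3`; least Kolyvagin primes `ℓ = 199` (`a_199 = −5`) for `997b1` and `ℓ = 229` (`a_229 = −25`) for
`997c1` — the SAME primes as the rows of record; JLS cost `3(ℓ+1)`), and there both twists carry small points: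
`(14276/121, 355460/1331)` on `[0, 92, 0, -42320, 2141392]` (`= [0, −23 b₂, 0, 8·23² b₄, −16·23³ b₆]` of `997b1`,
`u = 1/2`-isomorphic to `E^{(−23)}`) and `(458440/289, 305187452/4913)` on `[0, 92, 0, -203136, -42243824]` (`997c1`),
found by a residue-sieved search, on twists that are TORSION-FREE by the annihilator `t = 1` of three kernel point
counts. This file adds, for each of the two curves, the row `(5, −23)` READ EXACTLY on W. Zhang's ♠ cell
(`kolyvaginClass_prime_ne_zero_iff_rankTwo_shaTrivial_twistSelmer_of_lemma84`; every side condition a kernel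
theorem: `5` good ordinary, `ρ_{E,5^n}` onto, non-CM, ♠ (1) + semistable, Kodaira–Néron table, Heegner hypothesis
from the Kronecker symbol `(−23/997) = 1`, `2 ≤ rank` by `KernelCerts*.C<label>.two_le_rank`) and then, via
`natCard_selmerGroup_le_iff_rank_eq_one_sha₁₅` at the twist (kernel point through
`mordellWeilRank_quadraticTwist_eq_twistModel`; `E^{(−23)}[5]` irreducible as the twist of the onto `ρ̄_{E,5}`):

  «∃ frame, Kolyvagin prime `ℓ`, datum: `c_1(ℓ) ≠ 0`»  `↔`
  «`rank_ℤ E(ℚ) = 2` ∧ `Ш(E/ℚ)[5] = 0` ∧ `rank_ℤ E^{(−23)}(ℚ) = 1` ∧ `Ш(E^{(−23)}/ℚ)[5] = 0`»,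

for ANY imaginary quadratic `K` with `d_K = −23`; the first conjunct drops by `and_iff_right` the day a 2-descent
certificate for the curve lands. CONDITIONAL on (γ) = Gross 1991 Prop. 3.7 (2) and W. Zhang 2014 Lemma 8.4 (1) /
Thm. 9.1 BY NAME; per curve; BSD is NOT proved by any of this. With this file all 18 curves of the depth table
have a row whose twist side is in BSD invariants (15 rank-free, 3 modulo `rank E = 2`).

References: [WZhang2014] Lemma 8.4 (1) (p. 236), Thm. 9.1 (p. 240), Hypothesis ♠ (p. 195); [GrossLMS1991]
Prop. 3.7 (2); [SilvermanAEC2009] VII.3.1 (b), VIII.6.7, X.4.2, X.5 Cor. 5.4; [JetchevLauterStein2009] §3.6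
(arXiv:0707.0032); [Marcus1977] Ch. 3 Thm. 25; [CremonaAlgorithms1997] Table 1 (997b1, 997c1), §3.5.
-/

set_option linter.dupNamespace false

noncomputable section

open scoped Classical NumberField

namespace Summit.BirchSwinnertonDyer.BirchSwinnertonDyer.Theorems.KolyvaginDepthDoor

open Literature.NumberTheory.EllipticCurves Literature.NumberTheory.EllipticCurves.ModularForms
  WeierstrassCurve NumberField IsDedekindDomain
open Summit.BirchSwinnertonDyer.BirchSwinnertonDyer.Theorems
open Summit.BirchSwinnertonDyer.BirchSwinnertonDyer.Rank2Observatory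

/-! ## `997b1 = [0, -1, 1, -5, -3]` at `(p, d_K) = (5, −23)`: Heegner data, exact reading, twist model `[0, 92, 0, -42320, 2141392]`, kernel point `(14276/121, 355460/1331)` -/

namespace C997b1

/-- **Heegner data `d_K = -23` for `997b1`**: the one prime of `Δ = 997` (hence of `N_E`) splits in a quadratic field of
discriminant `-23` (Kronecker symbol `(−23/997) = 1`). [cite: Marcus1977, Ch. 3 Thm. 25] [cite: GrossLMS1991, §1] -/
theorem heegner_neg23 : ∀ q : ℕ, q.Prime → (q : ℤ) ∣ (⟨0, -1, 1, -5, -3⟩ : WeierstrassCurve ℤ).Δ →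
    (q = 2 → (-23 : ℤ) % 8 = 1) ∧ (q ≠ 2 → jacobiSym (-23) q = 1) :=
  forall_prime_dvd_of_natAbs_eq_pow (a := 997) (i := 1) (by decide +kernel) (by norm_num)
    ⟨by norm_num, by norm_num⟩

/-- **DEPTH-TABLE ROW `997b1`, `(p, d_K) = (5, −23)`, READ EXACTLY on the ♠ cell (two-sided; no `hF`, no twist
point, no twist pinning; `5` inert in `K`; `h_K = 3`, least Kolyvagin prime `ℓ = 199`, `a_199 = -5`, JLS cost
`3(ℓ+1) = 600`).** For `E = 997b1` (two independent points by `KernelCertsR01.C997b1.two_le_rank`) and ANY imaginary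
quadratic `K` with `d_K = −23`: «some frame, some Kolyvagin prime `ℓ`, some datum of conductor `ℓ` with `c_1(ℓ) ≠ 0`»
`↔` «`rank E(ℚ) = 2` ∧ `Ш(E/ℚ)[5] = 0` ∧ `#Sel_5(E^{(−23)}/ℚ) ≤ 5`». Side conditions all kernel theorems (`5` good
ordinary, `ρ_{E,5^n}` onto, non-CM, ♠ (1) + semistable from `Δ = 997`, Heegner for `N_E`). CONDITIONAL on (γ) and
W. Zhang's Lemma 8.4 (1) / Thm. 9.1 by name; per curve; BSD is not proved by it.
[cite: WZhang2014, Lemma 8.4 (1) (p. 236), Thm. 9.1 (p. 240)] [cite: GrossLMS1991, Prop. 3.7 (2)]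
[cite: JetchevLauterStein2009, §3.6 (arXiv:0707.0032)] [cite: CremonaAlgorithms1997, Table 1 (997b1)] -/
theorem exactRowZhang_5_neg23
    (h372 : GrossLMS1991.prop37_2_frobeniusCongruence)
    (h84 : Literature.NumberTheory.EllipticCurves.WZhang2014_lemma84_exists_minimal_kolyvaginClass_one_selmerCard)
    (K : Type) [Field K] [NumberField K] (hK : IsImaginaryQuadratic K)
    (hD : NumberField.discr K = -23) :
    haveI := isElliptic_c997b1;
    haveI := isGloballyMinimal_c997b1;
    haveI : NeZero (((⟨0, -1, 1, -5, -3⟩ : WeierstrassCurve ℤ).map (Int.castRingHom ℚ)).conductorNorm ℤ) := neZero_conductorNorm_of_isElliptic _;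
    haveI := Fact.mk (by norm_num : Nat.Prime 5);
    (∃ (Dt : ModularParametrizationData ((⟨0, -1, 1, -5, -3⟩ : WeierstrassCurve ℤ).map (Int.castRingHom ℚ)) (((⟨0, -1, 1, -5, -3⟩ : WeierstrassCurve ℤ).map (Int.castRingHom ℚ)).conductorNorm ℤ)) (β : ℤ)
      (ι : K →+* ℂ) (ℓ : ℕ) (d : KolyvaginHeegnerData Dt β ι ℓ),
      ℓ.Prime ∧ Zhang2014.IsKolyvaginPrime (((⟨0, -1, 1, -5, -3⟩ : WeierstrassCurve ℤ).map (Int.castRingHom ℚ)).conductorNorm ℤ) ((⟨0, -1, 1, -5, -3⟩ : WeierstrassCurve ℤ).map (Int.castRingHom ℚ)) K 5 ℓ ∧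
        d.kolyvaginClass (p := 5) (by norm_num) 1 ≠ 0) ↔
    (((⟨0, -1, 1, -5, -3⟩ : WeierstrassCurve ℤ).map (Int.castRingHom ℚ)).mordellWeilRank = 2 ∧
      (((⟨0, -1, 1, -5, -3⟩ : WeierstrassCurve ℤ).map (Int.castRingHom ℚ)).sha ⊓ AddSubgroup.torsionBy ((⟨0, -1, 1, -5, -3⟩ : WeierstrassCurve ℤ).map (Int.castRingHom ℚ)).galH1 ((5 : ℕ) : ℤ) : AddSubgroup _) = ⊥ ∧
      Nat.card ((((⟨0, -1, 1, -5, -3⟩ : WeierstrassCurve ℤ).map (Int.castRingHom ℚ)).quadraticTwist (NumberField.discr K : ℚ)).selmerGroup (5 : ℕ)) ≤ 5) := by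
  haveI := isElliptic_c997b1
  haveI := isGloballyMinimal_c997b1
  haveI : NeZero (((⟨0, -1, 1, -5, -3⟩ : WeierstrassCurve ℤ).map (Int.castRingHom ℚ)).conductorNorm ℤ) := neZero_conductorNorm_of_isElliptic _
  haveI := Fact.mk (by norm_num : Nat.Prime 5)
  have hgo := goodOrdinary_5
  have hsp := spade_5
  have hH := satisfiesHeegnerHypothesis_conductorNorm_of_intModel intModel K hK.1 hD heegner_neg23
  have hKN := not_dvd_ordMinimalDiscriminant_of_intModel_table intModel (p := 5) (Δ₀ := 997)
    (by decide +kernel) (B := 11) (by decide +kernel) (by decide +kernel)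
  have hS2 : ¬ Squarefree (((⟨0, -1, 1, -5, -3⟩ : WeierstrassCurve ℤ).map (Int.castRingHom ℚ)).conductorNorm ℤ) →
      (∃ (ℓ : ℕ) (_ : Fact ℓ.Prime), ((⟨0, -1, 1, -5, -3⟩ : WeierstrassCurve ℤ).map (Int.castRingHom ℚ)).HasMultiplicativeReductionAtPrime ℓ ∧
          ¬ 5 ∣ padicValInt ℓ ((⟨0, -1, 1, -5, -3⟩ : WeierstrassCurve ℤ).map (Int.castRingHom ℚ)).minimalDiscriminantInt) ∧
        ∃ (ℓ₁ ℓ₂ : ℕ) (_ : Fact ℓ₁.Prime) (_ : Fact ℓ₂.Prime), ℓ₁ ≠ ℓ₂ ∧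
          ((⟨0, -1, 1, -5, -3⟩ : WeierstrassCurve ℤ).map (Int.castRingHom ℚ)).HasMultiplicativeReductionAtPrime ℓ₁ ∧ ((⟨0, -1, 1, -5, -3⟩ : WeierstrassCurve ℤ).map (Int.castRingHom ℚ)).HasMultiplicativeReductionAtPrime ℓ₂ :=
    fun hns ↦ absurd (((⟨0, -1, 1, -5, -3⟩ : WeierstrassCurve ℤ).map (Int.castRingHom ℚ)).isSemistable_iff_squarefree_conductorNorm.mp hsp.2) hns
  have hD3 : NumberField.discr K ≠ -3 := by rw [hD]; norm_num
  have hD4 : NumberField.discr K ≠ -4 := by rw [hD]; norm_num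
  have hpD : ¬ (((5 : ℕ) : ℤ) ∣ NumberField.discr K) := by rw [hD]; norm_num
  exact kolyvaginClass_prime_ne_zero_iff_rankTwo_shaTrivial_twistSelmer_of_lemma84 h372 h84 _ not_hasCM
    KernelCertsR01.C997b1.two_le_rank 5 (by norm_num) hgo.1 hgo.2 hasSurjectiveModNGaloisRep_pow_5 hKN hsp.1 hS2 K
    hK hD3 hD4 hpD hH

/-- The twist model of `E^{(−23)}` for `E = 997b1`: `[0, −23 b₂, 0, 8·23² b₄, −16·23³ b₆] = [0, 92, 0, -42320, 2141392]`
(`ℚ`-isomorphic to `E^{(−23)}` by `u = 1/2`). [cite: SilvermanAEC2009, X.5 Cor. 5.4] -/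
theorem twistModel_neg23 :
    (⟨0, (-23) * (⟨0, -1, 1, -5, -3⟩ : WeierstrassCurve ℤ).b₂, 0, 8 * (-23) ^ 2 * (⟨0, -1, 1, -5, -3⟩ : WeierstrassCurve ℤ).b₄,
        16 * (-23) ^ 3 * (⟨0, -1, 1, -5, -3⟩ : WeierstrassCurve ℤ).b₆⟩ : WeierstrassCurve ℤ) = ⟨0, 92, 0, -42320, 2141392⟩ := by
  ext <;> decide +kernel

/-- The twist model `[0, 92, 0, -42320, 2141392]` is an elliptic curve over `ℚ` (`Δ ≠ 0`, kernel-checked). [folklore] -/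
theorem isElliptic_twist_neg23 : ((⟨0, 92, 0, -42320, 2141392⟩ : WeierstrassCurve ℤ).map (Int.castRingHom ℚ)).IsElliptic := by
  rw [WeierstrassCurve.isElliptic_iff, WeierstrassCurve.map_Δ, isUnit_iff_ne_zero, eq_intCast,
    Int.cast_ne_zero]
  decide +kernel

/-- Torsion killers for the twist model `[0, 92, 0, -42320, 2141392]`: kernel point counts `(q, #Ṽ(𝔽_q))` at the good
primes `(3, 5), (5, 2), (7, 6)`. [cite: SilvermanAEC2009, Prop. VII.3.1 (b)] -/
theorem killers_twist_neg23 : ∀ ℓN ∈ [((3 : ℕ), (5 : ℕ)), ((5 : ℕ), (2 : ℕ)), ((7 : ℕ), (6 : ℕ))], ℓN.1.Prime ∧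
    ∀ (x : ((⟨0, 92, 0, -42320, 2141392⟩ : WeierstrassCurve ℤ).map (Int.castRingHom ℚ)).toAffine.Point)
      (n : ℕ), ¬ ℓN.1 ∣ n → n • x = 0 → ℓN.2 • x = 0 :=
  killers_cons _ (q := 3) (N := 5) (by decide +kernel) (by decide +kernel)
    (killers_cons _ (q := 5) (N := 2) (by decide +kernel) (by decide +kernel)
      (killers_cons _ (q := 7) (N := 6) (by decide +kernel) (by decide +kernel)
        (killers_nil _)))

/-- **`E^{(−23)}(ℚ)` is torsion-free** (`E = 997b1`; twist model `[0, 92, 0, -42320, 2141392]`; annihilator `t = 1` from the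
kernel counts `(3, 5), (5, 2), (7, 6)`). [cite: SilvermanAEC2009, Prop. VII.3.1 (b)] -/
theorem torsionFree_twist_neg23 (x : ((⟨0, 92, 0, -42320, 2141392⟩ : WeierstrassCurve ℤ).map (Int.castRingHom ℚ)).toAffine.Point)
    (hx : IsOfFinAddOrder x) : x = 0 := by
  simpa only [one_smul] using
    nsmul_eq_zero_of_annihilatorCheck (t := 1) killers_twist_neg23 (by decide +kernel) hx

/-- **`1 ≤ rank_ℤ E^{(−23)}(ℚ)` for `E = 997b1` IN THE KERNEL**: the rational point `(14276/121, 355460/1331)` of the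
twist model `[0, 92, 0, -42320, 2141392]` (residue-sieved search over `x = u/w²`) is non-zero on a torsion-free curve, hence of
infinite order; Mordell–Weil. [cite: SilvermanAEC2009, Prop. VII.3.1 (b) and Thm. VIII.6.7] -/
theorem one_le_rank_twist_neg23 :
    1 ≤ ((⟨0, 92, 0, -42320, 2141392⟩ : WeierstrassCurve ℤ).map (Int.castRingHom ℚ)).mordellWeilRank := by
  haveI := isElliptic_twist_neg23
  have hP : ((⟨0, 92, 0, -42320, 2141392⟩ : WeierstrassCurve ℤ).map (Int.castRingHom ℚ)).toAffine.Nonsingular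
      ((14276 / 121 : ℚ)) ((355460 / 1331 : ℚ)) :=
    WeierstrassCurve.Affine.equation_iff_nonsingular.mp
      ((WeierstrassCurve.Affine.equation_iff _ _).mpr (by norm_num [WeierstrassCurve.map]))
  exact one_le_mordellWeilRank_of_not_isOfFinAddOrder _
    (((⟨0, 92, 0, -42320, 2141392⟩ : WeierstrassCurve ℤ).map (Int.castRingHom ℚ)).module_finite_point_holds)
    (fun hfin ↦ WeierstrassCurve.Affine.Point.some_ne_zero hP (torsionFree_twist_neg23 _ (by convert hfin)))

/-- **DEPTH-TABLE ROW `997b1`, `(p, d_K) = (5, −23)`, v12 modulo the rank of `E` — «ONE BIT ⟺ `rank E = 2` ∧ TWO `Ш`'s».**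
For `E = 997b1` and ANY imaginary quadratic `K` with `d_K = −23`: «some frame, some Kolyvagin prime `ℓ`, some datum
of conductor `ℓ` with `c_1(ℓ) ≠ 0`» `↔` «`rank_ℤ E(ℚ) = 2` ∧ `Ш(E/ℚ)[5] = 0` ∧ `rank_ℤ E^{(−23)}(ℚ) = 1` ∧
`Ш(E^{(−23)}/ℚ)[5] = 0`». From `exactRowZhang_5_neg23` and `natCard_selmerGroup_le_iff_rank_eq_one_sha₁₅` at the
twist, fed with the kernel point `one_le_rank_twist_neg23` (through `mordellWeilRank_quadraticTwist_eq_twistModel`)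
and the irreducibility of `E^{(−23)}[5]`. The `rank E = 2` conjunct stays (no 2-descent certificate for `997b1` in
the tree). CONDITIONAL on (γ) and W. Zhang's Lemma 8.4 (1) / Thm. 9.1 by name; per curve; BSD is not proved by it.
[cite: WZhang2014, Lemma 8.4 (1) (p. 236), Thm. 9.1 (p. 240)] [cite: GrossLMS1991, Prop. 3.7 (2)]
[cite: SilvermanAEC2009, Thm. X.4.2] [cite: CremonaAlgorithms1997, Table 1 (997b1)] -/
theorem exactRowZhang_5_neg23_twoShaModRank
    (h372 : GrossLMS1991.prop37_2_frobeniusCongruence)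
    (h84 : Literature.NumberTheory.EllipticCurves.WZhang2014_lemma84_exists_minimal_kolyvaginClass_one_selmerCard)
    (K : Type) [Field K] [NumberField K] (hK : IsImaginaryQuadratic K)
    (hD : NumberField.discr K = -23) :
    haveI := isElliptic_c997b1;
    haveI := isGloballyMinimal_c997b1;
    haveI : NeZero (((⟨0, -1, 1, -5, -3⟩ : WeierstrassCurve ℤ).map (Int.castRingHom ℚ)).conductorNorm ℤ) := neZero_conductorNorm_of_isElliptic _;
    haveI := Fact.mk (by norm_num : Nat.Prime 5);
    (∃ (Dt : ModularParametrizationData ((⟨0, -1, 1, -5, -3⟩ : WeierstrassCurve ℤ).map (Int.castRingHom ℚ)) (((⟨0, -1, 1, -5, -3⟩ : WeierstrassCurve ℤ).map (Int.castRingHom ℚ)).conductorNorm ℤ)) (β : ℤ)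
      (ι : K →+* ℂ) (ℓ : ℕ) (d : KolyvaginHeegnerData Dt β ι ℓ),
      ℓ.Prime ∧ Zhang2014.IsKolyvaginPrime (((⟨0, -1, 1, -5, -3⟩ : WeierstrassCurve ℤ).map (Int.castRingHom ℚ)).conductorNorm ℤ) ((⟨0, -1, 1, -5, -3⟩ : WeierstrassCurve ℤ).map (Int.castRingHom ℚ)) K 5 ℓ ∧
        d.kolyvaginClass (p := 5) (by norm_num) 1 ≠ 0) ↔
    (((⟨0, -1, 1, -5, -3⟩ : WeierstrassCurve ℤ).map (Int.castRingHom ℚ)).mordellWeilRank = 2 ∧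
      (((⟨0, -1, 1, -5, -3⟩ : WeierstrassCurve ℤ).map (Int.castRingHom ℚ)).sha ⊓ AddSubgroup.torsionBy ((⟨0, -1, 1, -5, -3⟩ : WeierstrassCurve ℤ).map (Int.castRingHom ℚ)).galH1 ((5 : ℕ) : ℤ) : AddSubgroup _) = ⊥ ∧
      (((⟨0, -1, 1, -5, -3⟩ : WeierstrassCurve ℤ).map (Int.castRingHom ℚ)).quadraticTwist (NumberField.discr K : ℚ)).mordellWeilRank = 1 ∧
      ((((⟨0, -1, 1, -5, -3⟩ : WeierstrassCurve ℤ).map (Int.castRingHom ℚ)).quadraticTwist (NumberField.discr K : ℚ)).sha ⊓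
          AddSubgroup.torsionBy (((⟨0, -1, 1, -5, -3⟩ : WeierstrassCurve ℤ).map (Int.castRingHom ℚ)).quadraticTwist (NumberField.discr K : ℚ)).galH1 ((5 : ℕ) : ℤ) :
          AddSubgroup (((⟨0, -1, 1, -5, -3⟩ : WeierstrassCurve ℤ).map (Int.castRingHom ℚ)).quadraticTwist (NumberField.discr K : ℚ)).galH1) = ⊥) := by
  haveI := isElliptic_c997b1
  haveI := isGloballyMinimal_c997b1
  haveI : NeZero (((⟨0, -1, 1, -5, -3⟩ : WeierstrassCurve ℤ).map (Int.castRingHom ℚ)).conductorNorm ℤ) := neZero_conductorNorm_of_isElliptic _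
  haveI := Fact.mk (by norm_num : Nat.Prime 5)
  have hdK : (NumberField.discr K : ℚ) ≠ 0 := by exact_mod_cast NumberField.discr_ne_zero K
  haveI := ((⟨0, -1, 1, -5, -3⟩ : WeierstrassCurve ℤ).map (Int.castRingHom ℚ)).isElliptic_quadraticTwist hdK
  have hsur : ((⟨0, -1, 1, -5, -3⟩ : WeierstrassCurve ℤ).map (Int.castRingHom ℚ)).HasSurjectiveModNGaloisRep (5 ^ 1 : ℕ) := hasSurjectiveModNGaloisRep_pow_5 1
  rw [pow_one] at hsur
  have hirrT : (((⟨0, -1, 1, -5, -3⟩ : WeierstrassCurve ℤ).map (Int.castRingHom ℚ)).quadraticTwist (NumberField.discr K : ℚ)).HasIrreducibleModPGaloisRep 5 :=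
    (((⟨0, -1, 1, -5, -3⟩ : WeierstrassCurve ℤ).map (Int.castRingHom ℚ)).hasIrreducibleModPGaloisRep_quadraticTwist_iff hdK 5).mpr
      (hasIrreducibleModPGaloisRep_of_hasSurjectiveModNGaloisRep ((⟨0, -1, 1, -5, -3⟩ : WeierstrassCurve ℤ).map (Int.castRingHom ℚ)) 5 hsur)
  have h1 : 1 ≤ (((⟨0, -1, 1, -5, -3⟩ : WeierstrassCurve ℤ).map (Int.castRingHom ℚ)).quadraticTwist (NumberField.discr K : ℚ)).mordellWeilRank := by
    rw [hD, mordellWeilRank_quadraticTwist_eq_twistModel intModel (-23), twistModel_neg23]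
    exact one_le_rank_twist_neg23
  exact (exactRowZhang_5_neg23 h372 h84 K hK hD).trans
    (and_congr_right fun _ ↦ and_congr_right fun _ ↦ natCard_selmerGroup_le_iff_rank_eq_one_sha₁₅ _ 5 hirrT h1)

end C997b1

/-! ## `997c1 = [0, -1, 1, -24, 54]` at `(p, d_K) = (5, −23)`: Heegner data, exact reading, twist model `[0, 92, 0, -203136, -42243824]`, kernel point `(458440/289, 305187452/4913)` -/

namespace C997c1

/-- **Heegner data `d_K = -23` for `997c1`**: the one prime of `Δ = 997` (hence of `N_E`) splits in a quadratic field of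
discriminant `-23` (Kronecker symbol `(−23/997) = 1`). [cite: Marcus1977, Ch. 3 Thm. 25] [cite: GrossLMS1991, §1] -/
theorem heegner_neg23 : ∀ q : ℕ, q.Prime → (q : ℤ) ∣ (⟨0, -1, 1, -24, 54⟩ : WeierstrassCurve ℤ).Δ →
    (q = 2 → (-23 : ℤ) % 8 = 1) ∧ (q ≠ 2 → jacobiSym (-23) q = 1) :=
  forall_prime_dvd_of_natAbs_eq_pow (a := 997) (i := 1) (by decide +kernel) (by norm_num)
    ⟨by norm_num, by norm_num⟩

/-- **DEPTH-TABLE ROW `997c1`, `(p, d_K) = (5, −23)`, READ EXACTLY on the ♠ cell (two-sided; no `hF`, no twist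
point, no twist pinning; `5` inert in `K`; `h_K = 3`, least Kolyvagin prime `ℓ = 229`, `a_229 = -25`, JLS cost
`3(ℓ+1) = 690`).** For `E = 997c1` (two independent points by `KernelCerts003.C997c1.two_le_rank`) and ANY imaginary
quadratic `K` with `d_K = −23`: «some frame, some Kolyvagin prime `ℓ`, some datum of conductor `ℓ` with `c_1(ℓ) ≠ 0`»
`↔` «`rank E(ℚ) = 2` ∧ `Ш(E/ℚ)[5] = 0` ∧ `#Sel_5(E^{(−23)}/ℚ) ≤ 5`». Side conditions all kernel theorems (`5` good
ordinary, `ρ_{E,5^n}` onto, non-CM, ♠ (1) + semistable from `Δ = 997`, Heegner for `N_E`). CONDITIONAL on (γ) and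
W. Zhang's Lemma 8.4 (1) / Thm. 9.1 by name; per curve; BSD is not proved by it.
[cite: WZhang2014, Lemma 8.4 (1) (p. 236), Thm. 9.1 (p. 240)] [cite: GrossLMS1991, Prop. 3.7 (2)]
[cite: JetchevLauterStein2009, §3.6 (arXiv:0707.0032)] [cite: CremonaAlgorithms1997, Table 1 (997c1)] -/
theorem exactRowZhang_5_neg23
    (h372 : GrossLMS1991.prop37_2_frobeniusCongruence)
    (h84 : Literature.NumberTheory.EllipticCurves.WZhang2014_lemma84_exists_minimal_kolyvaginClass_one_selmerCard)
    (K : Type) [Field K] [NumberField K] (hK : IsImaginaryQuadratic K)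
    (hD : NumberField.discr K = -23) :
    haveI := isElliptic_c997c1;
    haveI := isGloballyMinimal_c997c1;
    haveI : NeZero (((⟨0, -1, 1, -24, 54⟩ : WeierstrassCurve ℤ).map (Int.castRingHom ℚ)).conductorNorm ℤ) := neZero_conductorNorm_of_isElliptic _;
    haveI := Fact.mk (by norm_num : Nat.Prime 5);
    (∃ (Dt : ModularParametrizationData ((⟨0, -1, 1, -24, 54⟩ : WeierstrassCurve ℤ).map (Int.castRingHom ℚ)) (((⟨0, -1, 1, -24, 54⟩ : WeierstrassCurve ℤ).map (Int.castRingHom ℚ)).conductorNorm ℤ)) (β : ℤ)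
      (ι : K →+* ℂ) (ℓ : ℕ) (d : KolyvaginHeegnerData Dt β ι ℓ),
      ℓ.Prime ∧ Zhang2014.IsKolyvaginPrime (((⟨0, -1, 1, -24, 54⟩ : WeierstrassCurve ℤ).map (Int.castRingHom ℚ)).conductorNorm ℤ) ((⟨0, -1, 1, -24, 54⟩ : WeierstrassCurve ℤ).map (Int.castRingHom ℚ)) K 5 ℓ ∧
        d.kolyvaginClass (p := 5) (by norm_num) 1 ≠ 0) ↔
    (((⟨0, -1, 1, -24, 54⟩ : WeierstrassCurve ℤ).map (Int.castRingHom ℚ)).mordellWeilRank = 2 ∧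
      (((⟨0, -1, 1, -24, 54⟩ : WeierstrassCurve ℤ).map (Int.castRingHom ℚ)).sha ⊓ AddSubgroup.torsionBy ((⟨0, -1, 1, -24, 54⟩ : WeierstrassCurve ℤ).map (Int.castRingHom ℚ)).galH1 ((5 : ℕ) : ℤ) : AddSubgroup _) = ⊥ ∧
      Nat.card ((((⟨0, -1, 1, -24, 54⟩ : WeierstrassCurve ℤ).map (Int.castRingHom ℚ)).quadraticTwist (NumberField.discr K : ℚ)).selmerGroup (5 : ℕ)) ≤ 5) := by
  haveI := isElliptic_c997c1
  haveI := isGloballyMinimal_c997c1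
  haveI : NeZero (((⟨0, -1, 1, -24, 54⟩ : WeierstrassCurve ℤ).map (Int.castRingHom ℚ)).conductorNorm ℤ) := neZero_conductorNorm_of_isElliptic _
  haveI := Fact.mk (by norm_num : Nat.Prime 5)
  have hgo := goodOrdinary_5
  have hsp := spade_5
  have hH := satisfiesHeegnerHypothesis_conductorNorm_of_intModel intModel K hK.1 hD heegner_neg23
  have hKN := not_dvd_ordMinimalDiscriminant_of_intModel_table intModel (p := 5) (Δ₀ := 997)
    (by decide +kernel) (B := 11) (by decide +kernel) (by decide +kernel)
  have hS2 : ¬ Squarefree (((⟨0, -1, 1, -24, 54⟩ : WeierstrassCurve ℤ).map (Int.castRingHom ℚ)).conductorNorm ℤ) →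
      (∃ (ℓ : ℕ) (_ : Fact ℓ.Prime), ((⟨0, -1, 1, -24, 54⟩ : WeierstrassCurve ℤ).map (Int.castRingHom ℚ)).HasMultiplicativeReductionAtPrime ℓ ∧
          ¬ 5 ∣ padicValInt ℓ ((⟨0, -1, 1, -24, 54⟩ : WeierstrassCurve ℤ).map (Int.castRingHom ℚ)).minimalDiscriminantInt) ∧
        ∃ (ℓ₁ ℓ₂ : ℕ) (_ : Fact ℓ₁.Prime) (_ : Fact ℓ₂.Prime), ℓ₁ ≠ ℓ₂ ∧
          ((⟨0, -1, 1, -24, 54⟩ : WeierstrassCurve ℤ).map (Int.castRingHom ℚ)).HasMultiplicativeReductionAtPrime ℓ₁ ∧ ((⟨0, -1, 1, -24, 54⟩ : WeierstrassCurve ℤ).map (Int.castRingHom ℚ)).HasMultiplicativeReductionAtPrime ℓ₂ :=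
    fun hns ↦ absurd (((⟨0, -1, 1, -24, 54⟩ : WeierstrassCurve ℤ).map (Int.castRingHom ℚ)).isSemistable_iff_squarefree_conductorNorm.mp hsp.2) hns
  have hD3 : NumberField.discr K ≠ -3 := by rw [hD]; norm_num
  have hD4 : NumberField.discr K ≠ -4 := by rw [hD]; norm_num
  have hpD : ¬ (((5 : ℕ) : ℤ) ∣ NumberField.discr K) := by rw [hD]; norm_num
  exact kolyvaginClass_prime_ne_zero_iff_rankTwo_shaTrivial_twistSelmer_of_lemma84 h372 h84 _ not_hasCM
    KernelCerts003.C997c1.two_le_rank 5 (by norm_num) hgo.1 hgo.2 hasSurjectiveModNGaloisRep_pow_5 hKN hsp.1 hS2 K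
    hK hD3 hD4 hpD hH

/-- The twist model of `E^{(−23)}` for `E = 997c1`: `[0, −23 b₂, 0, 8·23² b₄, −16·23³ b₆] = [0, 92, 0, -203136, -42243824]`
(`ℚ`-isomorphic to `E^{(−23)}` by `u = 1/2`). [cite: SilvermanAEC2009, X.5 Cor. 5.4] -/
theorem twistModel_neg23 :
    (⟨0, (-23) * (⟨0, -1, 1, -24, 54⟩ : WeierstrassCurve ℤ).b₂, 0, 8 * (-23) ^ 2 * (⟨0, -1, 1, -24, 54⟩ : WeierstrassCurve ℤ).b₄,
        16 * (-23) ^ 3 * (⟨0, -1, 1, -24, 54⟩ : WeierstrassCurve ℤ).b₆⟩ : WeierstrassCurve ℤ) = ⟨0, 92, 0, -203136, -42243824⟩ := by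
  ext <;> decide +kernel

/-- The twist model `[0, 92, 0, -203136, -42243824]` is an elliptic curve over `ℚ` (`Δ ≠ 0`, kernel-checked). [folklore] -/
theorem isElliptic_twist_neg23 : ((⟨0, 92, 0, -203136, -42243824⟩ : WeierstrassCurve ℤ).map (Int.castRingHom ℚ)).IsElliptic := by
  rw [WeierstrassCurve.isElliptic_iff, WeierstrassCurve.map_Δ, isUnit_iff_ne_zero, eq_intCast,
    Int.cast_ne_zero]
  decide +kernel

/-- Torsion killers for the twist model `[0, 92, 0, -203136, -42243824]`: kernel point counts `(q, #Ṽ(𝔽_q))` at the good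
primes `(3, 5), (5, 4), (7, 4)`. [cite: SilvermanAEC2009, Prop. VII.3.1 (b)] -/
theorem killers_twist_neg23 : ∀ ℓN ∈ [((3 : ℕ), (5 : ℕ)), ((5 : ℕ), (4 : ℕ)), ((7 : ℕ), (4 : ℕ))], ℓN.1.Prime ∧
    ∀ (x : ((⟨0, 92, 0, -203136, -42243824⟩ : WeierstrassCurve ℤ).map (Int.castRingHom ℚ)).toAffine.Point)
      (n : ℕ), ¬ ℓN.1 ∣ n → n • x = 0 → ℓN.2 • x = 0 :=
  killers_cons _ (q := 3) (N := 5) (by decide +kernel) (by decide +kernel)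
    (killers_cons _ (q := 5) (N := 4) (by decide +kernel) (by decide +kernel)
      (killers_cons _ (q := 7) (N := 4) (by decide +kernel) (by decide +kernel)
        (killers_nil _)))

/-- **`E^{(−23)}(ℚ)` is torsion-free** (`E = 997c1`; twist model `[0, 92, 0, -203136, -42243824]`; annihilator `t = 1` from the
kernel counts `(3, 5), (5, 4), (7, 4)`). [cite: SilvermanAEC2009, Prop. VII.3.1 (b)] -/
theorem torsionFree_twist_neg23 (x : ((⟨0, 92, 0, -203136, -42243824⟩ : WeierstrassCurve ℤ).map (Int.castRingHom ℚ)).toAffine.Point)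
    (hx : IsOfFinAddOrder x) : x = 0 := by
  simpa only [one_smul] using
    nsmul_eq_zero_of_annihilatorCheck (t := 1) killers_twist_neg23 (by decide +kernel) hx

/-- **`1 ≤ rank_ℤ E^{(−23)}(ℚ)` for `E = 997c1` IN THE KERNEL**: the rational point `(458440/289, 305187452/4913)` of the
twist model `[0, 92, 0, -203136, -42243824]` (residue-sieved search over `x = u/w²`) is non-zero on a torsion-free curve, hence of
infinite order; Mordell–Weil. [cite: SilvermanAEC2009, Prop. VII.3.1 (b) and Thm. VIII.6.7] -/
theorem one_le_rank_twist_neg23 :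
    1 ≤ ((⟨0, 92, 0, -203136, -42243824⟩ : WeierstrassCurve ℤ).map (Int.castRingHom ℚ)).mordellWeilRank := by
  haveI := isElliptic_twist_neg23
  have hP : ((⟨0, 92, 0, -203136, -42243824⟩ : WeierstrassCurve ℤ).map (Int.castRingHom ℚ)).toAffine.Nonsingular
      ((458440 / 289 : ℚ)) ((305187452 / 4913 : ℚ)) :=
    WeierstrassCurve.Affine.equation_iff_nonsingular.mp
      ((WeierstrassCurve.Affine.equation_iff _ _).mpr (by norm_num [WeierstrassCurve.map]))
  exact one_le_mordellWeilRank_of_not_isOfFinAddOrder _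
    (((⟨0, 92, 0, -203136, -42243824⟩ : WeierstrassCurve ℤ).map (Int.castRingHom ℚ)).module_finite_point_holds)
    (fun hfin ↦ WeierstrassCurve.Affine.Point.some_ne_zero hP (torsionFree_twist_neg23 _ (by convert hfin)))

/-- **DEPTH-TABLE ROW `997c1`, `(p, d_K) = (5, −23)`, v12 modulo the rank of `E` — «ONE BIT ⟺ `rank E = 2` ∧ TWO `Ш`'s».**
For `E = 997c1` and ANY imaginary quadratic `K` with `d_K = −23`: «some frame, some Kolyvagin prime `ℓ`, some datum
of conductor `ℓ` with `c_1(ℓ) ≠ 0`» `↔` «`rank_ℤ E(ℚ) = 2` ∧ `Ш(E/ℚ)[5] = 0` ∧ `rank_ℤ E^{(−23)}(ℚ) = 1` ∧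
`Ш(E^{(−23)}/ℚ)[5] = 0`». From `exactRowZhang_5_neg23` and `natCard_selmerGroup_le_iff_rank_eq_one_sha₁₅` at the
twist, fed with the kernel point `one_le_rank_twist_neg23` (through `mordellWeilRank_quadraticTwist_eq_twistModel`)
and the irreducibility of `E^{(−23)}[5]`. The `rank E = 2` conjunct stays (no 2-descent certificate for `997c1` in
the tree). CONDITIONAL on (γ) and W. Zhang's Lemma 8.4 (1) / Thm. 9.1 by name; per curve; BSD is not proved by it.
[cite: WZhang2014, Lemma 8.4 (1) (p. 236), Thm. 9.1 (p. 240)] [cite: GrossLMS1991, Prop. 3.7 (2)]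
[cite: SilvermanAEC2009, Thm. X.4.2] [cite: CremonaAlgorithms1997, Table 1 (997c1)] -/
theorem exactRowZhang_5_neg23_twoShaModRank
    (h372 : GrossLMS1991.prop37_2_frobeniusCongruence)
    (h84 : Literature.NumberTheory.EllipticCurves.WZhang2014_lemma84_exists_minimal_kolyvaginClass_one_selmerCard)
    (K : Type) [Field K] [NumberField K] (hK : IsImaginaryQuadratic K)
    (hD : NumberField.discr K = -23) :
    haveI := isElliptic_c997c1;
    haveI := isGloballyMinimal_c997c1;
    haveI : NeZero (((⟨0, -1, 1, -24, 54⟩ : WeierstrassCurve ℤ).map (Int.castRingHom ℚ)).conductorNorm ℤ) := neZero_conductorNorm_of_isElliptic _;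
    haveI := Fact.mk (by norm_num : Nat.Prime 5);
    (∃ (Dt : ModularParametrizationData ((⟨0, -1, 1, -24, 54⟩ : WeierstrassCurve ℤ).map (Int.castRingHom ℚ)) (((⟨0, -1, 1, -24, 54⟩ : WeierstrassCurve ℤ).map (Int.castRingHom ℚ)).conductorNorm ℤ)) (β : ℤ)
      (ι : K →+* ℂ) (ℓ : ℕ) (d : KolyvaginHeegnerData Dt β ι ℓ),
      ℓ.Prime ∧ Zhang2014.IsKolyvaginPrime (((⟨0, -1, 1, -24, 54⟩ : WeierstrassCurve ℤ).map (Int.castRingHom ℚ)).conductorNorm ℤ) ((⟨0, -1, 1, -24, 54⟩ : WeierstrassCurve ℤ).map (Int.castRingHom ℚ)) K 5 ℓ ∧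
        d.kolyvaginClass (p := 5) (by norm_num) 1 ≠ 0) ↔
    (((⟨0, -1, 1, -24, 54⟩ : WeierstrassCurve ℤ).map (Int.castRingHom ℚ)).mordellWeilRank = 2 ∧
      (((⟨0, -1, 1, -24, 54⟩ : WeierstrassCurve ℤ).map (Int.castRingHom ℚ)).sha ⊓ AddSubgroup.torsionBy ((⟨0, -1, 1, -24, 54⟩ : WeierstrassCurve ℤ).map (Int.castRingHom ℚ)).galH1 ((5 : ℕ) : ℤ) : AddSubgroup _) = ⊥ ∧
      (((⟨0, -1, 1, -24, 54⟩ : WeierstrassCurve ℤ).map (Int.castRingHom ℚ)).quadraticTwist (NumberField.discr K : ℚ)).mordellWeilRank = 1 ∧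
      ((((⟨0, -1, 1, -24, 54⟩ : WeierstrassCurve ℤ).map (Int.castRingHom ℚ)).quadraticTwist (NumberField.discr K : ℚ)).sha ⊓
          AddSubgroup.torsionBy (((⟨0, -1, 1, -24, 54⟩ : WeierstrassCurve ℤ).map (Int.castRingHom ℚ)).quadraticTwist (NumberField.discr K : ℚ)).galH1 ((5 : ℕ) : ℤ) :
          AddSubgroup (((⟨0, -1, 1, -24, 54⟩ : WeierstrassCurve ℤ).map (Int.castRingHom ℚ)).quadraticTwist (NumberField.discr K : ℚ)).galH1) = ⊥) := by
  haveI := isElliptic_c997c1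
  haveI := isGloballyMinimal_c997c1
  haveI : NeZero (((⟨0, -1, 1, -24, 54⟩ : WeierstrassCurve ℤ).map (Int.castRingHom ℚ)).conductorNorm ℤ) := neZero_conductorNorm_of_isElliptic _
  haveI := Fact.mk (by norm_num : Nat.Prime 5)
  have hdK : (NumberField.discr K : ℚ) ≠ 0 := by exact_mod_cast NumberField.discr_ne_zero K
  haveI := ((⟨0, -1, 1, -24, 54⟩ : WeierstrassCurve ℤ).map (Int.castRingHom ℚ)).isElliptic_quadraticTwist hdK
  have hsur : ((⟨0, -1, 1, -24, 54⟩ : WeierstrassCurve ℤ).map (Int.castRingHom ℚ)).HasSurjectiveModNGaloisRep (5 ^ 1 : ℕ) := hasSurjectiveModNGaloisRep_pow_5 1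
  rw [pow_one] at hsur
  have hirrT : (((⟨0, -1, 1, -24, 54⟩ : WeierstrassCurve ℤ).map (Int.castRingHom ℚ)).quadraticTwist (NumberField.discr K : ℚ)).HasIrreducibleModPGaloisRep 5 :=
    (((⟨0, -1, 1, -24, 54⟩ : WeierstrassCurve ℤ).map (Int.castRingHom ℚ)).hasIrreducibleModPGaloisRep_quadraticTwist_iff hdK 5).mpr
      (hasIrreducibleModPGaloisRep_of_hasSurjectiveModNGaloisRep ((⟨0, -1, 1, -24, 54⟩ : WeierstrassCurve ℤ).map (Int.castRingHom ℚ)) 5 hsur)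
  have h1 : 1 ≤ (((⟨0, -1, 1, -24, 54⟩ : WeierstrassCurve ℤ).map (Int.castRingHom ℚ)).quadraticTwist (NumberField.discr K : ℚ)).mordellWeilRank := by
    rw [hD, mordellWeilRank_quadraticTwist_eq_twistModel intModel (-23), twistModel_neg23]
    exact one_le_rank_twist_neg23
  exact (exactRowZhang_5_neg23 h372 h84 K hK hD).trans
    (and_congr_right fun _ ↦ and_congr_right fun _ ↦ natCard_selmerGroup_le_iff_rank_eq_one_sha₁₅ _ 5 hirrT h1)

end C997c1

end Summit.BirchSwinnertonDyer.BirchSwinnertonDyer.Theorems.KolyvaginDepthDoor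

end
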